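import Mathlib
import Summits.Ventures.HodgeRepro.Tier4.Line1.RTFSetting
import Summits.Ventures.HodgeRepro.Tier4.Line1.RtfGeometric
import Summits.Ventures.HodgeRepro.Tier4.Line4.KernelL1
import Summits.Ventures.HodgeRepro.Tier4.Line4.L1Class
import Summits.Ventures.HodgeRepro.Tier4.Line4.RtfGeometricL1
import Summits.Ventures.HodgeRepro.Tier4.Line4.TailBound

/-!
# Tier4/Line4/TailBoundL1 — the tail of the geometric side bounded by the `L¹`-norms of `f` along the twisted orbits
(no sup-norm, no full-measure factor)

Blind re-derivation cell `pub-hodge-repro`, Tier 4 «prove the step» (README §9–§10), seat t4-L4-p2 (prover, LINE L4,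
gen 4; C-L4-TAILL1, S15137, on t4-crit-1 g9's objection O-L4-FIBRE-SCALE S15135: the sup-norm tail bound
`M · μ_{T′}(D_{T′}) · μ_T(D_T)` of TailBound is lossy by the level measure on a shrinking level family, so its `hM` and the
main-term lower bound `hmain` cannot be paired on one normalisation).  Tree path
`lean/Summits/Ventures/HodgeRepro/Tier4/Line4/TailBoundL1.lean`.  Mathlib-level; no literature; no `def`.

THE LOSS-FREE FORM.  For a continuous `f` with the uniform Poincaré bound (`L1Class.PoincareSummable S f`) and any set `E`
of double cosets,
  `‖∑'_{o ∉ E} O_o(f)‖ ≤ ∑'_{γ ∉ E} ∫_{D_T}∫_{D_{T′}} ‖f(t⁻¹ γ t')‖ dt' dt`  (`norm_tsum_orbital_compl_le_tsum_integral`),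
the sum over the rational points outside `E` of the `L¹(D_T × D_{T′})`-norms of `f` along the twisted orbits
`(t, t') ↦ t⁻¹ γ t'`, with the family of these norms summable (`summable_integral_norm_orbit`).  For the product witness
`finf ⊗ ffin_N` each term factors (InnerSplit's `innerFull_eq_mul_of_prod` over the product domains): the archimedean
`L¹`-norm along the orbit of `γ_∞` (the decay) times the FINITE-PART LEVEL MEASURE of `γ` — the quantity on which the
main term and the tail are to be compared.

PROOF.  `‖O_o(f)‖ ≤ ∫_{D_T} ∫_{D_{T′}} ‖K_f^o‖ ≤ ∫∫ ∑'_{γ ∈ o} ‖f(t⁻¹ γ t')‖ = ∑'_{γ ∈ o} ∫∫ ‖f(t⁻¹ γ t')‖`: the tsum of norms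
over a fibre is strongly measurable (a pointwise limit of finite sums of continuous functions along the countably
generated `atTop` of finite sets, as in KernelL1), bounded on the closures of the domains, hence integrable; the two
interchanges `∫ ∑' = ∑' ∫` are `integral_tsum_of_summable_integral_norm` with the summability from bounded partial sums
(`∑_{γ ∈ s} ∫∫ ‖f‖ = ∫∫ ∑_{γ ∈ s} ‖f‖ ≤ M · μ_{T′}(D_{T′}) · μ_T(D_T)`).  Then the fibre sums over finitely many double
cosets outside `E` are bounded by the full sum outside `E` (`HasSum.tsum_fiberwise`, as in TailBound), and
`Real.tsum_le_of_sum_le` / `norm_tsum_le_tsum_norm` finish.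

Nothing here says anything about the status of the Hodge conjecture for CM abelian varieties, which is NOT proved
(HC_CM is NOT proved by anyone in this repository).
-/

set_option autoImplicit false

noncomputable section

namespace Summit.Ventures.HodgeRepro.Tier4.Line4

open MeasureTheory Topology Filter Set Summit.Ventures.HodgeRepro.Tier4 Summit.Ventures.HodgeRepro.Tier4.Line1
  Summit.Ventures.HodgeRepro.Tier4.Line1.RTF

variable {G : Type} [Group G] [TopologicalSpace G] [IsTopologicalGroup G] [MeasurableSpace G] [BorelSpace G]
  (S : Setting G)

/-! ## 1. The tsum of norms over a set of rational points: measurability, integrability, the interchange -/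

section NormSums

variable [SecondCountableTopology G] [Countable S.Gk]

/-- The sum of the norms of `f` over the rational points of a set `A`, as a function on `G × G`, is strongly measurable
(a pointwise limit of finite sums of continuous functions along `atTop : Filter (Finset A)`). -/
theorem stronglyMeasurable_tsum_norm_subtype {f : G → ℂ} (hf : Continuous f)
    (hs : ∀ x y : G, Summable (fun γ : S.Gk => ‖f (x⁻¹ * γ * y)‖)) (A : Set S.Gk) :
    StronglyMeasurable (fun p : G × G => ∑' γ : A, ‖f (p.1⁻¹ * γ.1 * p.2)‖) := by
  refine stronglyMeasurable_of_tendsto (atTop : Filter (Finset A))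
    (f := fun F : Finset A => fun p : G × G => ∑ γ ∈ F, ‖f (p.1⁻¹ * γ.1 * p.2)‖) (fun F => ?_) ?_
  · exact (continuous_finsetSum F fun γ _ =>
      (hf.comp ((continuous_fst.inv.mul continuous_const).mul continuous_snd)).norm).stronglyMeasurable
  · rw [tendsto_pi_nhds]
    intro p
    exact ((hs p.1 p.2).subtype A).hasSum

/-- The same on the tori `S.T × S.T'`. -/
theorem stronglyMeasurable_tsum_norm_subtype_torus {f : G → ℂ} (hf : Continuous f)
    (hs : ∀ x y : G, Summable (fun γ : S.Gk => ‖f (x⁻¹ * γ * y)‖)) (A : Set S.Gk) :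
    StronglyMeasurable (fun p : S.T × S.T' => ∑' γ : A, ‖f ((p.1 : G)⁻¹ * γ.1 * p.2)‖) :=
  (stronglyMeasurable_tsum_norm_subtype S hf hs A).comp_measurable
    ((measurable_subtype_coe.comp measurable_fst).prodMk (measurable_subtype_coe.comp measurable_snd))

omit [IsTopologicalGroup G] [BorelSpace G] [SecondCountableTopology G] [Countable S.Gk] in
/-- The sum of norms over `A` is bounded by the full Poincaré series. -/
theorem tsum_norm_subtype_le {f : G → ℂ} (hs : ∀ x y : G, Summable (fun γ : S.Gk => ‖f (x⁻¹ * γ * y)‖))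
    (A : Set S.Gk) (x y : G) :
    ∑' γ : A, ‖f (x⁻¹ * γ.1 * y)‖ ≤ ∑' γ : S.Gk, ‖f (x⁻¹ * γ * y)‖ :=
  Summable.tsum_subtype_le (fun γ : S.Gk => ‖f (x⁻¹ * γ * y)‖) A (fun _ => norm_nonneg _) (hs x y)

omit [SecondCountableTopology G] [Countable S.Gk] in
/-- `t' ↦ ‖f(t⁻¹ γ t')‖` is integrable on `D_{T′}` (continuous on the compact closure). -/
theorem integrableOn_norm_orbit_DT' {f : G → ℂ} (hf : Continuous f) (γ : S.Gk) (t : S.T) :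
    IntegrableOn (fun t' : S.T' => ‖f ((t : G)⁻¹ * γ * t')‖) S.DT' S.μT' := by
  haveI : IsFiniteMeasureOnCompacts S.μT' := S.haarT'.toIsFiniteMeasureOnCompacts
  have hc : Continuous fun t' : S.T' => ‖f ((t : G)⁻¹ * γ * t')‖ :=
    (hf.comp (continuous_const.mul continuous_subtype_val)).norm
  exact (hc.continuousOn.integrableOn_compact' S.compT' isClosed_closure.measurableSet).mono_set subset_closure

omit [SecondCountableTopology G] [Countable S.Gk] in
/-- The inner integrals of the norms along the orbits are bounded by `M · μ_{T′}(D_{T′})` on `closure D_T`, for every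
finite set of rational points at once. -/
theorem sum_integral_norm_orbit_DT'_le {f : G → ℂ} (hf : Continuous f) {M : ℝ}
    (hM : ∀ t ∈ closure S.DT, ∀ t' ∈ closure S.DT', ∑' γ : S.Gk, ‖f ((t : G)⁻¹ * γ * t')‖ ≤ M)
    (hs : ∀ x y : G, Summable (fun γ : S.Gk => ‖f (x⁻¹ * γ * y)‖)) (s : Finset S.Gk) {t : S.T}
    (ht : t ∈ closure S.DT) :
    ∑ γ ∈ s, ∫ t' in S.DT', ‖f ((t : G)⁻¹ * γ * t')‖ ∂S.μT' ≤ M * S.μT'.real S.DT' := by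
  rw [← integral_finsetSum _ fun γ _ => integrableOn_norm_orbit_DT' S hf γ t]
  refine (Real.le_norm_self _).trans (norm_setIntegral_le_of_norm_le_const (measure_DT'_lt_top S)
    fun t' ht' => ?_)
  rw [Real.norm_of_nonneg (Finset.sum_nonneg fun γ _ => norm_nonneg _)]
  exact ((hs t t').sum_le_tsum s fun γ _ => norm_nonneg _).trans (hM t ht t' (subset_closure ht'))

omit [SecondCountableTopology G] in
/-- **The inner interchange**: `∫_{D_{T′}} ∑'_{γ ∈ A} ‖f(t⁻¹ γ t')‖ dt' = ∑'_{γ ∈ A} ∫_{D_{T′}} ‖f(t⁻¹ γ t')‖ dt'` for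
`t ∈ closure D_T` (`integral_tsum_of_summable_integral_norm`, the summability from bounded partial sums). -/
theorem integral_tsum_norm_subtype_DT' {f : G → ℂ} (hf : Continuous f) {M : ℝ}
    (hM : ∀ t ∈ closure S.DT, ∀ t' ∈ closure S.DT', ∑' γ : S.Gk, ‖f ((t : G)⁻¹ * γ * t')‖ ≤ M)
    (hs : ∀ x y : G, Summable (fun γ : S.Gk => ‖f (x⁻¹ * γ * y)‖)) (A : Set S.Gk) {t : S.T}
    (ht : t ∈ closure S.DT) :
    ∫ t' in S.DT', ∑' γ : A, ‖f ((t : G)⁻¹ * γ.1 * t')‖ ∂S.μT' =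
      ∑' γ : A, ∫ t' in S.DT', ‖f ((t : G)⁻¹ * γ.1 * t')‖ ∂S.μT' := by
  have hint : ∀ γ : A, Integrable (fun t' : S.T' => ‖f ((t : G)⁻¹ * γ.1 * t')‖) (S.μT'.restrict S.DT') :=
    fun γ => integrableOn_norm_orbit_DT' S hf γ.1 t
  refine (integral_tsum_of_summable_integral_norm hint ?_).symm
  refine summable_of_sum_le (fun γ => integral_nonneg fun _ => norm_nonneg _) (c := M * S.μT'.real S.DT')
    fun s => ?_
  simp only [norm_norm]
  have h := sum_integral_norm_orbit_DT'_le S hf hM hs (s.map (Function.Embedding.subtype _)) ht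
  rwa [Finset.sum_map] at h

omit [SecondCountableTopology G] [Countable S.Gk] in
/-- `t ↦ ∫_{D_{T′}} ‖f(t⁻¹ γ t')‖ dt'` is continuous on `T` (the tube lemma of `RtfGeometric`, through the complexification). -/
theorem continuous_integral_norm_orbit_DT' {f : G → ℂ} (hf : Continuous f) (γ : S.Gk) :
    Continuous (fun t : S.T => ∫ t' in S.DT', ‖f ((t : G)⁻¹ * γ * t')‖ ∂S.μT') := by
  haveI : IsFiniteMeasureOnCompacts S.μT' := S.haarT'.toIsFiniteMeasureOnCompacts
  have hF : Continuous (Function.uncurry fun (t : S.T) (t' : S.T') =>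
      ((‖f ((t : G)⁻¹ * γ * t')‖ : ℝ) : ℂ)) := by
    apply Complex.continuous_ofReal.comp
    exact (hf.comp (((continuous_subtype_val.comp continuous_fst).inv.mul continuous_const).mul
      (continuous_subtype_val.comp continuous_snd))).norm
  have h := RTF.Geometric.continuous_setIntegral_of_continuous_uncurry (μ := S.μT') S.compT' hF
  have heq : (fun t : S.T => ∫ t' in S.DT', ((‖f ((t : G)⁻¹ * γ * t')‖ : ℝ) : ℂ) ∂S.μT') =
      fun t : S.T => ((∫ t' in S.DT', ‖f ((t : G)⁻¹ * γ * t')‖ ∂S.μT' : ℝ) : ℂ) := by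
    funext t
    exact integral_complex_ofReal
  rw [heq] at h
  have h' := Complex.continuous_re.comp h
  simpa only [Function.comp_def, Complex.ofReal_re] using h'

omit [SecondCountableTopology G] [Countable S.Gk] in
/-- `t ↦ ∫_{D_{T′}} ‖f(t⁻¹ γ t')‖ dt'` is integrable on `D_T`. -/
theorem integrableOn_integral_norm_orbit_DT {f : G → ℂ} (hf : Continuous f) (γ : S.Gk) :
    IntegrableOn (fun t : S.T => ∫ t' in S.DT', ‖f ((t : G)⁻¹ * γ * t')‖ ∂S.μT') S.DT S.μT := by
  haveI : IsFiniteMeasureOnCompacts S.μT := S.haarT.toIsFiniteMeasureOnCompacts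
  exact ((continuous_integral_norm_orbit_DT' S hf γ).continuousOn.integrableOn_compact' S.compT
    isClosed_closure.measurableSet).mono_set subset_closure

omit [SecondCountableTopology G] [Countable S.Gk] in
/-- **The `L¹`-norms of `f` along the twisted orbits are summable**: `∑_γ ∫_{D_T}∫_{D_{T′}} ‖f(t⁻¹ γ t')‖ ≤ M · μ_{T′}(D_{T′}) · μ_T(D_T)`
(bounded partial sums). -/
theorem summable_integral_norm_orbit {f : G → ℂ} (hf : Continuous f) {M : ℝ}
    (hM : ∀ t ∈ closure S.DT, ∀ t' ∈ closure S.DT', ∑' γ : S.Gk, ‖f ((t : G)⁻¹ * γ * t')‖ ≤ M)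
    (hs : ∀ x y : G, Summable (fun γ : S.Gk => ‖f (x⁻¹ * γ * y)‖)) :
    Summable (fun γ : S.Gk => ∫ t in S.DT, ∫ t' in S.DT', ‖f ((t : G)⁻¹ * γ * t')‖ ∂S.μT' ∂S.μT) := by
  refine summable_of_sum_le (fun γ => integral_nonneg fun _ => integral_nonneg fun _ => norm_nonneg _)
    (c := M * S.μT'.real S.DT' * S.μT.real S.DT) fun s => ?_
  rw [← integral_finsetSum _ fun γ _ => integrableOn_integral_norm_orbit_DT S hf γ]
  refine (Real.le_norm_self _).trans (norm_setIntegral_le_of_norm_le_const (measure_DT_lt_top S)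
    fun t ht => ?_)
  rw [Real.norm_of_nonneg (Finset.sum_nonneg fun γ _ => integral_nonneg fun _ => norm_nonneg _)]
  exact sum_integral_norm_orbit_DT'_le S hf hM hs s (subset_closure ht)

omit [SecondCountableTopology G] in
/-- **The outer interchange**: `∫_{D_T} ∑'_{γ ∈ A} (∫_{D_{T′}} ‖f(t⁻¹ γ t')‖ dt') dt = ∑'_{γ ∈ A} ∫_{D_T}∫_{D_{T′}} ‖f(t⁻¹ γ t')‖`. -/
theorem integral_tsum_integral_norm_subtype_DT {f : G → ℂ} (hf : Continuous f) {M : ℝ}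
    (hM : ∀ t ∈ closure S.DT, ∀ t' ∈ closure S.DT', ∑' γ : S.Gk, ‖f ((t : G)⁻¹ * γ * t')‖ ≤ M)
    (hs : ∀ x y : G, Summable (fun γ : S.Gk => ‖f (x⁻¹ * γ * y)‖)) (A : Set S.Gk) :
    ∫ t in S.DT, ∑' γ : A, ∫ t' in S.DT', ‖f ((t : G)⁻¹ * γ.1 * t')‖ ∂S.μT' ∂S.μT =
      ∑' γ : A, ∫ t in S.DT, ∫ t' in S.DT', ‖f ((t : G)⁻¹ * γ.1 * t')‖ ∂S.μT' ∂S.μT := by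
  have hint : ∀ γ : A, Integrable (fun t : S.T => ∫ t' in S.DT', ‖f ((t : G)⁻¹ * γ.1 * t')‖ ∂S.μT')
      (S.μT.restrict S.DT) := fun γ => integrableOn_integral_norm_orbit_DT S hf γ.1
  refine (integral_tsum_of_summable_integral_norm hint ?_).symm
  refine ((summable_integral_norm_orbit S hf hM hs).subtype A).congr fun γ => ?_
  refine integral_congr_ae (Eventually.of_forall fun t => ?_)
  simp only
  rw [Real.norm_of_nonneg (integral_nonneg fun _ => norm_nonneg _)]

/-- The inner tsum of norms over `A` is integrable on `D_{T′}` for `t ∈ closure D_T` (strongly measurable, bounded by `M`). -/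
theorem integrableOn_tsum_norm_subtype_DT' {f : G → ℂ} (hf : Continuous f) {M : ℝ}
    (hM : ∀ t ∈ closure S.DT, ∀ t' ∈ closure S.DT', ∑' γ : S.Gk, ‖f ((t : G)⁻¹ * γ * t')‖ ≤ M)
    (hs : ∀ x y : G, Summable (fun γ : S.Gk => ‖f (x⁻¹ * γ * y)‖)) (A : Set S.Gk) {t : S.T}
    (ht : t ∈ closure S.DT) :
    IntegrableOn (fun t' : S.T' => ∑' γ : A, ‖f ((t : G)⁻¹ * γ.1 * t')‖) S.DT' S.μT' := by
  refine IntegrableOn.of_bound (measure_DT'_lt_top S) ?_ M ?_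
  · exact ((stronglyMeasurable_tsum_norm_subtype_torus S hf hs A).comp_measurable
      (measurable_const.prodMk measurable_id)).aestronglyMeasurable
  · refine ae_restrict_of_ae_restrict_of_subset subset_closure ?_
    rw [ae_restrict_iff' isClosed_closure.measurableSet]
    refine Eventually.of_forall fun t' ht' => ?_
    rw [Real.norm_of_nonneg (tsum_nonneg fun _ => norm_nonneg _)]
    exact (tsum_norm_subtype_le S hs A t t').trans (hM t ht t' ht')

/-- **One orbital term is bounded by the `L¹`-norms of `f` along the twisted orbits of its double coset**:
`‖O_o(f)‖ ≤ ∑'_{γ ∈ o} ∫_{D_T}∫_{D_{T′}} ‖f(t⁻¹ γ t')‖`. -/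
theorem norm_orbital_le_tsum_integral {χ : S.T → ℂ} {χ' : S.T' → ℂ} (hu : ∀ a, ‖χ a‖ = 1)
    (hu' : ∀ a, ‖χ' a‖ = 1) {f : G → ℂ} (hf : Continuous f) {M : ℝ}
    (hM : ∀ t ∈ closure S.DT, ∀ t' ∈ closure S.DT', ∑' γ : S.Gk, ‖f ((t : G)⁻¹ * γ * t')‖ ≤ M)
    (hs : ∀ x y : G, Summable (fun γ : S.Gk => ‖f (x⁻¹ * γ * y)‖)) (o : S.Orbit) :
    ‖S.orbital χ χ' o f‖ ≤
      ∑' γ : {γ : S.Gk // S.orbitOf γ = o}, ∫ t in S.DT, ∫ t' in S.DT', ‖f ((t : G)⁻¹ * γ.1 * t')‖ ∂S.μT' ∂S.μT := by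
  -- the fibre as a set of rational points
  set A : Set S.Gk := {γ | S.orbitOf γ = o} with hA
  -- the pointwise bound of the inner integral on `closure D_T`
  have hinner : ∀ t ∈ closure S.DT,
      ‖∫ t' in S.DT', S.partialKernel o f t t' * χ t * starRingEnd ℂ (χ' t') ∂S.μT'‖ ≤
        ∑' γ : A, ∫ t' in S.DT', ‖f ((t : G)⁻¹ * γ.1 * t')‖ ∂S.μT' := by
    intro t ht
    rw [← integral_tsum_norm_subtype_DT' S hf hM hs A ht]
    refine (norm_integral_le_integral_norm _).trans ?_
    refine integral_mono_of_nonneg (Eventually.of_forall fun _ => norm_nonneg _)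
      (integrableOn_tsum_norm_subtype_DT' S hf hM hs A ht) (Eventually.of_forall fun t' => ?_)
    simp only
    rw [norm_mul, norm_mul, Complex.norm_conj, hu, hu', mul_one, mul_one]
    exact norm_partialKernel_le_tsum_fiber S hs o t t'
  -- the outer integral
  have houter : IntegrableOn (fun t : S.T => ∑' γ : A, ∫ t' in S.DT', ‖f ((t : G)⁻¹ * γ.1 * t')‖ ∂S.μT')
      S.DT S.μT := by
    haveI : IsFiniteMeasure (S.μT'.restrict S.DT') := isFiniteMeasure_restrict.mpr (measure_DT'_lt_top S).ne
    haveI : SecondCountableTopology S.T := Topology.IsEmbedding.subtypeVal.secondCountableTopology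
    -- strongly measurable through the inner interchange on the closure, bounded by `M μ_{T′}(D_{T′})`
    have hmeas : StronglyMeasurable
        (fun t : S.T => ∫ t' in S.DT', ∑' γ : A, ‖f ((t : G)⁻¹ * γ.1 * t')‖ ∂S.μT') :=
      (stronglyMeasurable_tsum_norm_subtype_torus S hf hs A).integral_prod_right'
    refine (IntegrableOn.of_bound (measure_DT_lt_top S)
      (f := fun t : S.T => ∫ t' in S.DT', ∑' γ : A, ‖f ((t : G)⁻¹ * γ.1 * t')‖ ∂S.μT') ?_
      (M * S.μT'.real S.DT') ?_).congr ?_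
    · exact hmeas.aestronglyMeasurable
    · refine ae_restrict_of_ae_restrict_of_subset subset_closure ?_
      rw [ae_restrict_iff' isClosed_closure.measurableSet]
      refine Eventually.of_forall fun t ht => ?_
      refine norm_setIntegral_le_of_norm_le_const (measure_DT'_lt_top S) fun t' ht' => ?_
      rw [Real.norm_of_nonneg (tsum_nonneg fun _ => norm_nonneg _)]
      exact (tsum_norm_subtype_le S hs A t t').trans (hM t ht t' (subset_closure ht'))
    · refine ae_restrict_of_ae_restrict_of_subset subset_closure ?_
      rw [ae_restrict_iff' isClosed_closure.measurableSet]
      exact Eventually.of_forall fun t ht => integral_tsum_norm_subtype_DT' S hf hM hs A ht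
  calc ‖S.orbital χ χ' o f‖
      ≤ ∫ t in S.DT, ‖∫ t' in S.DT', S.partialKernel o f t t' * χ t * starRingEnd ℂ (χ' t') ∂S.μT'‖ ∂S.μT :=
        norm_integral_le_integral_norm _
    _ ≤ ∫ t in S.DT, ∑' γ : A, ∫ t' in S.DT', ‖f ((t : G)⁻¹ * γ.1 * t')‖ ∂S.μT' ∂S.μT := by
        refine integral_mono_of_nonneg (Eventually.of_forall fun _ => norm_nonneg _) houter ?_
        refine ae_restrict_of_ae_restrict_of_subset subset_closure ?_
        rw [ae_restrict_iff' isClosed_closure.measurableSet]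
        exact Eventually.of_forall fun t ht => hinner t ht
    _ = ∑' γ : A, ∫ t in S.DT, ∫ t' in S.DT', ‖f ((t : G)⁻¹ * γ.1 * t')‖ ∂S.μT' ∂S.μT :=
        integral_tsum_integral_norm_subtype_DT S hf hM hs A

end NormSums

/-! ## 2. The tail bounded by the `L¹`-norms along the orbits off `E` -/

section TailL1

variable [SecondCountableTopology G]

omit [IsTopologicalGroup G] [BorelSpace G] [SecondCountableTopology G] in
/-- The fibre sums of a non-negative summable family over finitely many double cosets outside `E` are bounded by the
full sum over the rational points outside `E` (the generic form of TailBound's fibre lemma). -/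
theorem sum_tsum_fiber_compl_le {a : S.Gk → ℝ} (ha : ∀ γ, 0 ≤ a γ) (hs : Summable a) (E : Set S.Orbit)
    (s : Finset ↑Eᶜ) :
    ∑ o ∈ s, ∑' γ : {γ : S.Gk // S.orbitOf γ = o.1}, a γ.1 ≤ ∑' γ : {γ : S.Gk // S.orbitOf γ ∈ Eᶜ}, a γ.1 := by
  have hT : Summable (fun γ : {γ : S.Gk // S.orbitOf γ ∈ Eᶜ} => a γ.1) := hs.subtype _
  have h := hT.hasSum.tsum_fiberwise
    (fun γ : {γ : S.Gk // S.orbitOf γ ∈ Eᶜ} => (⟨S.orbitOf γ.1, γ.2⟩ : ↑Eᶜ))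
  have hle := h.summable.sum_le_tsum s (fun o _ => tsum_nonneg fun γ => ha _)
  rw [h.tsum_eq] at hle
  refine le_trans (le_of_eq ?_) hle
  refine Finset.sum_congr rfl fun o _ => ?_
  let e : ((fun γ : {γ : S.Gk // S.orbitOf γ ∈ Eᶜ} => (⟨S.orbitOf γ.1, γ.2⟩ : ↑Eᶜ)) ⁻¹' {o}) ≃
      {γ : S.Gk // S.orbitOf γ = o.1} :=
    { toFun := fun γ => ⟨γ.1.1, congrArg Subtype.val (Set.mem_singleton_iff.mp γ.2)⟩
      invFun := fun γ => ⟨⟨γ.1, by rw [γ.2]; exact o.2⟩, Set.mem_singleton_iff.mpr (Subtype.ext γ.2)⟩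
      left_inv := fun _ => rfl
      right_inv := fun _ => rfl }
  exact (e.tsum_eq (fun γ : {γ : S.Gk // S.orbitOf γ = o.1} => a γ.1)).symm

/-- **THE LOSS-FREE TAIL BOUND**: `‖∑'_{o ∉ E} O_o(f)‖ ≤ ∑'_{γ ∉ E} ∫_{D_T}∫_{D_{T′}} ‖f(t⁻¹ γ t')‖` — the tail of the
geometric side is bounded by the `L¹(D_T × D_{T′})`-norms of `f` along the twisted orbits of the rational points outside
`E`; no sup over the domains, no full-measure factor.  The family of orbital terms off `E` is summable in norm. -/
theorem norm_tsum_orbital_compl_le_tsum_integral {χ : S.T → ℂ} {χ' : S.T' → ℂ} (hχ : S.IsCharacter χ)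
    (hχ' : S.IsCharacter' χ') {f : G → ℂ} (hf : Continuous f) (hP : L1Class.PoincareSummable S f)
    (E : Set S.Orbit) :
    Summable (fun o : ↑Eᶜ => ‖S.orbital χ χ' o.1 f‖) ∧
      ‖∑' o : ↑Eᶜ, S.orbital χ χ' o.1 f‖ ≤
        ∑' γ : {γ : S.Gk // S.orbitOf γ ∈ Eᶜ}, ∫ t in S.DT, ∫ t' in S.DT', ‖f ((t : G)⁻¹ * γ.1 * t')‖ ∂S.μT' ∂S.μT := by
  haveI : Countable S.Gk := countable_Gk S
  have hs := summable_norm_of_poincareUniform S hP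
  obtain ⟨M, hM⟩ := exists_bound_tsum_norm_closure S hP
  have hsumγ := summable_integral_norm_orbit S hf hM hs
  have key : ∀ s : Finset ↑Eᶜ, ∑ o ∈ s, ‖S.orbital χ χ' o.1 f‖ ≤
      ∑' γ : {γ : S.Gk // S.orbitOf γ ∈ Eᶜ}, ∫ t in S.DT, ∫ t' in S.DT', ‖f ((t : G)⁻¹ * γ.1 * t')‖ ∂S.μT' ∂S.μT := by
    intro s
    calc ∑ o ∈ s, ‖S.orbital χ χ' o.1 f‖
        ≤ ∑ o ∈ s, ∑' γ : {γ : S.Gk // S.orbitOf γ = o.1},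
            ∫ t in S.DT, ∫ t' in S.DT', ‖f ((t : G)⁻¹ * γ.1 * t')‖ ∂S.μT' ∂S.μT :=
          Finset.sum_le_sum fun o _ => norm_orbital_le_tsum_integral S hχ.unit hχ'.unit hf hM hs o.1
      _ ≤ _ := sum_tsum_fiber_compl_le S
          (fun γ => integral_nonneg fun _ => integral_nonneg fun _ => norm_nonneg _) hsumγ E s
  have hsum : Summable (fun o : ↑Eᶜ => ‖S.orbital χ χ' o.1 f‖) := summable_of_sum_le (fun _ => norm_nonneg _) key
  exact ⟨hsum, (norm_tsum_le_tsum_norm hsum).trans (Real.tsum_le_of_sum_le (fun _ => norm_nonneg _) key)⟩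

/-- **`J(f)` minus the fibre sum, loss-free**: `‖J(f) − ∑_{o ∈ E} O_o(f)‖ ≤ ∑'_{γ ∉ E} ∫_{D_T}∫_{D_{T′}} ‖f(t⁻¹ γ t')‖` for a
finite set `E` of double cosets. -/
theorem norm_J_sub_sum_le_tsum_integral {χ : S.T → ℂ} {χ' : S.T' → ℂ} (hχ : S.IsCharacter χ)
    (hχ' : S.IsCharacter' χ') {f : G → ℂ} (hf : Continuous f) (hP : L1Class.PoincareSummable S f)
    (E : Finset S.Orbit) :
    ‖S.J χ χ' f - ∑ o ∈ E, S.orbital χ χ' o f‖ ≤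
      ∑' γ : {γ : S.Gk // S.orbitOf γ ∈ (E : Set S.Orbit)ᶜ},
        ∫ t in S.DT, ∫ t' in S.DT', ‖f ((t : G)⁻¹ * γ.1 * t')‖ ∂S.μT' ∂S.μT := by
  rw [J_eq_sum_add_tsum_compl S hχ hχ' hf hP E, add_sub_cancel_left]
  exact (norm_tsum_orbital_compl_le_tsum_integral S hχ hχ' hf hP (E : Set S.Orbit)).2

end TailL1

end Summit.Ventures.HodgeRepro.Tier4.Line4

end
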